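import Literature.RingTheory.MvPowerSeries.MonoidPowerSeries
import Literature.AlgebraicGeometry.Resolution.AdicNoetherian
import HarnessLib

/-!
# `R⟦P⟧` as a quotient of a power series ring in finitely many variables; Noetherianity

`Literature/RingTheory/MvPowerSeries/MonoidPowerSeriesGenerators.lean`. Continuation of
`MonoidPowerSeries.lean` (K. Kato, *Toric singularities*, Amer. J. Math. 116 (1994), §3). For a
submonoid `P ⊆ ℕ^{(σ)}` generated by finitely many NON-ZERO exponents `g₁, …, g_m`, the
substitution `X_i ↦ x^{g_i}` defines an `R`-algebra homomorphism
`R⟦X₁, …, X_m⟧ → R⟦x_s : s ∈ σ⟧` (Mathlib's `MvPowerSeries.subst`; substitutable because the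
monomials `x^{g_i}` have no constant term) whose IMAGE IS EXACTLY `R⟦P⟧`
(`monoidPowerSeries.range_substGenerators`): every `P`-supported series `∑_{p ∈ P} a_p x^p` is
`∑_p a_p X^{c(p)}` substituted, for any choice of representations `p = ∑ c(p)_i g_i`. This is how
Kato computes in `R[[P]]` ("take an injective homomorphism `P → ℕ^s`", proof of Lemma (3.4)),
and it gives at once: `R⟦P⟧` is Noetherian when `R` is (`monoidPowerSeries.isNoetherianRing`,
via the tree's `isNoetherianRing_mvPowerSeries`). Also recorded here: the finiteness criterion
`monoidPowerSeries.finite_fibre_of_degree_le` for the push-forward of `MonoidPowerSeries.lean`.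

References: [Kato1994] K. Kato, Toric singularities, Amer. J. Math. 116 (1994), §3.
-/

noncomputable section

open MvPowerSeries

namespace Literature.RingTheory.MvPowerSeries

namespace monoidPowerSeries

universe u v w

variable {σ : Type u} {R : Type v} [CommRing R]

/-! ### A finiteness criterion for fibres of maps of exponents -/

/-- If `σ` is finite and the degree of every exponent in `P` is bounded by a fixed multiple of the
degree of its image, `|p| ≤ C·|c p|`, then `c` has finite fibres on `P` (each fibre lies in the
finite set of exponents of degree `≤ C·|e|`) — the hypothesis of `monoidPowerSeries.pushforward`.
[cite: Kato1994, §3] -/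
theorem finite_fibre_of_degree_le [Finite σ] {τ : Type w} {P : AddSubmonoid (σ →₀ ℕ)}
    (c : (σ →₀ ℕ) → (τ →₀ ℕ)) (C : ℕ) (hC : ∀ p ∈ P, p.degree ≤ C * (c p).degree)
    (e : τ →₀ ℕ) : {p : σ →₀ ℕ | p ∈ P ∧ c p = e}.Finite := by
  classical
  have hfinK : ∀ K : ℕ, {p : σ →₀ ℕ | p.degree ≤ K}.Finite := by
    intro K
    haveI := Fintype.ofFinite σ
    have hsub : {p : σ →₀ ℕ | p.degree ≤ K} ⊆
        Set.range (fun v : σ → Fin (K + 1) =>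
          Finsupp.equivFunOnFinite.symm (fun i => (v i : ℕ))) := by
      intro p hp
      refine ⟨fun i => ⟨p i, Nat.lt_succ_of_le ((Finsupp.le_degree i p).trans hp)⟩, ?_⟩
      ext i
      simp
    exact (Set.finite_range _).subset hsub
  refine (hfinK (C * e.degree)).subset ?_
  rintro p ⟨hp, hce⟩
  simp only [Set.mem_setOf_eq]
  rw [← hce]
  exact hC p hp

/-! ### Substituting monomials for the variables -/

section Generators

variable {ι : Type w} [Finite ι] (g : ι → (σ →₀ ℕ))

/-- The exponent `∑ᵢ dᵢ • gᵢ ∈ ℕ^{(σ)}` of the monomial `∏ᵢ (x^{gᵢ})^{dᵢ}`. [cite: Kato1994, §3] -/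
def expSum (d : ι →₀ ℕ) : σ →₀ ℕ := d.sum fun i n => n • g i

omit [Finite ι] in
/-- `expSum` is additive. [cite: Kato1994, §3] -/
theorem expSum_add (d d' : ι →₀ ℕ) : expSum g (d + d') = expSum g d + expSum g d' := by
  classical
  unfold expSum
  rw [Finsupp.sum_add_index']
  · intro i
    rw [zero_smul]
  · intro i m n
    rw [add_smul]

omit [Finite ι] in
/-- `expSum 0 = 0`. [cite: Kato1994, §3] -/
theorem expSum_zero : expSum g (0 : ι →₀ ℕ) = 0 := by
  unfold expSum
  rw [Finsupp.sum_zero_index]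

omit [Finite ι] in
/-- `expSum` of a basis vector is the corresponding generator. [cite: Kato1994, §3] -/
theorem expSum_single (i : ι) (n : ℕ) : expSum g (Finsupp.single i n) = n • g i := by
  unfold expSum
  rw [Finsupp.sum_single_index]
  rw [zero_smul]

omit [Finite ι] in
/-- `expSum g d` lies in the submonoid generated by the `gᵢ`. [cite: Kato1994, §3] -/
theorem expSum_mem_closure (d : ι →₀ ℕ) :
    expSum g d ∈ AddSubmonoid.closure (Set.range g) := by
  classical
  unfold expSum Finsupp.sum
  refine AddSubmonoid.sum_mem _ fun i _ => AddSubmonoid.nsmul_mem _ ?_ _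
  exact AddSubmonoid.subset_closure ⟨i, rfl⟩

omit [Finite ι] in
/-- Every element of the submonoid generated by the `gᵢ` is an `expSum`. [cite: Kato1994, §3] -/
theorem exists_expSum_eq_of_mem_closure {p : σ →₀ ℕ}
    (hp : p ∈ AddSubmonoid.closure (Set.range g)) : ∃ d : ι →₀ ℕ, expSum g d = p := by
  classical
  induction hp using AddSubmonoid.closure_induction with
  | mem x hx =>
    obtain ⟨i, rfl⟩ := hx
    exact ⟨Finsupp.single i 1, by rw [expSum_single, one_smul]⟩
  | zero => exact ⟨0, expSum_zero g⟩
  | add x y _ _ hx hy =>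
    obtain ⟨d, rfl⟩ := hx
    obtain ⟨d', rfl⟩ := hy
    exact ⟨d + d', expSum_add g d d'⟩

omit [Finite ι] in
/-- The product `∏ᵢ (x^{gᵢ})^{dᵢ}` of powers of monomials is the monomial `x^{expSum g d}`.
[cite: Kato1994, §3] -/
theorem prod_pow_monomial (d : ι →₀ ℕ) :
    (d.prod fun i n => (MvPowerSeries.monomial (g i) (1 : R)) ^ n) =
      MvPowerSeries.monomial (expSum g d) 1 := by
  classical
  unfold expSum Finsupp.prod Finsupp.sum
  induction d.support using Finset.induction_on with
  | empty => rw [Finset.prod_empty, Finset.sum_empty, MvPowerSeries.monomial_zero_one]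
  | insert i s hi ih =>
    rw [Finset.prod_insert hi, Finset.sum_insert hi, ih]
    dsimp only
    rw [MvPowerSeries.monomial_pow, one_pow, MvPowerSeries.monomial_mul_monomial, one_mul]

/-- The monomials `x^{gᵢ}` (`gᵢ ≠ 0`) can be substituted for the variables of `R⟦Xᵢ : i ∈ ι⟧`
(`ι` finite): they have zero constant term. [cite: Kato1994, §3] -/
theorem hasSubst_monomial (hg0 : ∀ i, g i ≠ 0) :
    MvPowerSeries.HasSubst (fun i => MvPowerSeries.monomial (g i) (1 : R)) := by
  classical
  refine MvPowerSeries.hasSubst_of_constantCoeff_zero fun i => ?_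
  rw [← MvPowerSeries.coeff_zero_eq_constantCoeff_apply, MvPowerSeries.coeff_monomial,
    if_neg (fun h => hg0 i h.symm)]

open Classical in
/-- Coefficients of a substituted series: the coefficient of `x^e` in `F(x^{g₁}, …, x^{g_m})` is
the (finite) sum of the coefficients `F_d` over the exponents `d` with `∑ dᵢ gᵢ = e`.
[cite: Kato1994, §3] -/
theorem coeff_subst_monomial (hg0 : ∀ i, g i ≠ 0) (F : MvPowerSeries ι R) (e : σ →₀ ℕ) :
    MvPowerSeries.coeff e (MvPowerSeries.subst (fun i => MvPowerSeries.monomial (g i) (1 : R)) F) =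
      finsum fun d : ι →₀ ℕ => if expSum g d = e then MvPowerSeries.coeff d F else 0 := by
  classical
  rw [MvPowerSeries.coeff_subst (hasSubst_monomial g hg0)]
  refine finsum_congr fun d => ?_
  rw [prod_pow_monomial, MvPowerSeries.coeff_monomial]
  by_cases h : expSum g d = e
  · rw [if_pos h.symm, if_pos h, smul_eq_mul, mul_one]
  · rw [if_neg (fun h' => h h'.symm), if_neg h, smul_zero]

/-- The `R`-algebra homomorphism `R⟦Xᵢ : i ∈ ι⟧ → R⟦x_s : s ∈ σ⟧`, `Xᵢ ↦ x^{gᵢ}`.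
[cite: Kato1994, §3] -/
def substGenerators (hg0 : ∀ i, g i ≠ 0) : MvPowerSeries ι R →ₐ[R] MvPowerSeries σ R :=
  MvPowerSeries.substAlgHom (hasSubst_monomial (R := R) g hg0)

/-- `substGenerators` is substitution of the monomials `x^{gᵢ}`. [cite: Kato1994, §3] -/
theorem substGenerators_apply (hg0 : ∀ i, g i ≠ 0) (F : MvPowerSeries ι R) :
    substGenerators (R := R) g hg0 F =
      MvPowerSeries.subst (fun i => MvPowerSeries.monomial (g i) (1 : R)) F := by
  rw [substGenerators, MvPowerSeries.coe_substAlgHom]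

/-- The image of `Xᵢ ↦ x^{gᵢ}` consists of series supported on the submonoid `P = ⟨g₁, …, g_m⟩`.
[cite: Kato1994, §3] -/
theorem substGenerators_mem (hg0 : ∀ i, g i ≠ 0) {P : AddSubmonoid (σ →₀ ℕ)}
    (hP : AddSubmonoid.closure (Set.range g) ≤ P) (F : MvPowerSeries ι R) :
    substGenerators (R := R) g hg0 F ∈ monoidPowerSeries R P := by
  classical
  intro e he
  rw [substGenerators_apply, coeff_subst_monomial g hg0]
  refine finsum_eq_zero_of_forall_eq_zero fun d => ?_
  rw [if_neg]
  rintro rfl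
  exact he (hP (expSum_mem_closure g d))

/-- Every series supported on `P = ⟨g₁, …, g_m⟩` is in the image of `Xᵢ ↦ x^{gᵢ}`: choosing for
each `p ∈ P` one representation `p = ∑ c(p)ᵢ gᵢ`, the series `∑_p a_p X^{c(p)}` maps to
`∑_p a_p x^p`. [cite: Kato1994, §3] -/
theorem exists_substGenerators_eq (hg0 : ∀ i, g i ≠ 0) {P : AddSubmonoid (σ →₀ ℕ)}
    (hP : P ≤ AddSubmonoid.closure (Set.range g)) {f : MvPowerSeries σ R}
    (hf : f ∈ monoidPowerSeries R P) : ∃ F : MvPowerSeries ι R, substGenerators (R := R) g hg0 F = f := by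
  classical
  -- a section of `expSum` over `P`
  have hsec : ∀ p : σ →₀ ℕ, p ∈ P → ∃ d : ι →₀ ℕ, expSum g d = p :=
    fun p hp => exists_expSum_eq_of_mem_closure g (hP hp)
  choose s hs using hsec
  -- the lifted series: coefficient `f_p` at `s p`, zero elsewhere
  let F : MvPowerSeries ι R := fun d =>
    if h : expSum g d ∈ P then
      (if s (expSum g d) h = d then MvPowerSeries.coeff (expSum g d) f else 0) else 0
  have hF : ∀ d, MvPowerSeries.coeff d F =
      if h : expSum g d ∈ P then
        (if s (expSum g d) h = d then MvPowerSeries.coeff (expSum g d) f else 0) else 0 :=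
    fun d => rfl
  refine ⟨F, ?_⟩
  ext e
  rw [substGenerators_apply, coeff_subst_monomial g hg0]
  by_cases he : e ∈ P
  · -- only `d = s e` contributes
    rw [finsum_eq_single _ (s e he)]
    · have hse : expSum g (s e he) = e := hs e he
      rw [if_pos hse, hF, dif_pos (hse.symm ▸ he)]
      have : s (expSum g (s e he)) (hse.symm ▸ he) = s e he := by
        congr 1
      rw [if_pos this, hse]
    · intro d hd
      by_cases hde : expSum g d = e
      · rw [if_pos hde, hF, dif_pos (hde.symm ▸ he), if_neg]
        intro h2
        apply hd
        rw [← h2]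
        congr 1
      · rw [if_neg hde]
  · rw [hf e he]
    refine finsum_eq_zero_of_forall_eq_zero fun d => ?_
    by_cases hde : expSum g d = e
    · rw [if_pos hde, hF, dif_neg (fun h1 => he (hde ▸ h1))]
    · rw [if_neg hde]

/-- **`R⟦P⟧` is the image of `R⟦X₁, …, X_m⟧ → R⟦x⟧`, `Xᵢ ↦ x^{gᵢ}`**, for
`P = ⟨g₁, …, g_m⟩` with all `gᵢ ≠ 0`. [cite: Kato1994, §3 (proof of Lemma 3.4)] -/
theorem range_substGenerators (hg0 : ∀ i, g i ≠ 0) {P : AddSubmonoid (σ →₀ ℕ)}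
    (hP : AddSubmonoid.closure (Set.range g) = P) :
    (substGenerators (R := R) g hg0).range = monoidPowerSeries R P := by
  refine le_antisymm ?_ ?_
  · rintro _ ⟨F, rfl⟩
    exact substGenerators_mem g hg0 hP.le F
  · intro f hf
    obtain ⟨F, hF⟩ := exists_substGenerators_eq g hg0 hP.ge hf
    exact ⟨F, hF⟩

/-- The surjection `R⟦X₁, …, X_m⟧ → R⟦P⟧`, `Xᵢ ↦ x^{gᵢ}`, onto the completed monoid algebra of
`P = ⟨g₁, …, g_m⟩` (`gᵢ ≠ 0`). [cite: Kato1994, §3] -/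
def substGeneratorsOnto (hg0 : ∀ i, g i ≠ 0) {P : AddSubmonoid (σ →₀ ℕ)}
    (hP : AddSubmonoid.closure (Set.range g) = P) :
    MvPowerSeries ι R →ₐ[R] monoidPowerSeries R P :=
  (substGenerators (R := R) g hg0).codRestrict (monoidPowerSeries R P)
    fun F => substGenerators_mem g hg0 hP.le F

/-- `substGeneratorsOnto` composed with the inclusion is `substGenerators`. [cite: Kato1994, §3] -/
theorem coe_substGeneratorsOnto (hg0 : ∀ i, g i ≠ 0) {P : AddSubmonoid (σ →₀ ℕ)}
    (hP : AddSubmonoid.closure (Set.range g) = P) (F : MvPowerSeries ι R) :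
    (substGeneratorsOnto (R := R) g hg0 hP F : MvPowerSeries σ R) = substGenerators g hg0 F :=
  rfl

/-- `substGeneratorsOnto` is surjective. [cite: Kato1994, §3] -/
theorem substGeneratorsOnto_surjective (hg0 : ∀ i, g i ≠ 0) {P : AddSubmonoid (σ →₀ ℕ)}
    (hP : AddSubmonoid.closure (Set.range g) = P) :
    Function.Surjective (substGeneratorsOnto (R := R) g hg0 hP) := by
  intro f
  obtain ⟨F, hF⟩ := exists_substGenerators_eq g hg0 hP.ge f.2
  exact ⟨F, Subtype.ext hF⟩

end Generators

/-! ### Noetherianity -/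

/-- A finitely generated submonoid of `ℕ^{(σ)}` is generated by finitely many NON-ZERO
exponents (drop the zero generators). [folklore] -/
private theorem exists_generators_ne_zero {P : AddSubmonoid (σ →₀ ℕ)} (hP : P.FG) :
    ∃ (m : ℕ) (g : Fin m → (σ →₀ ℕ)), (∀ i, g i ≠ 0) ∧ AddSubmonoid.closure (Set.range g) = P := by
  classical
  obtain ⟨S, hS⟩ := hP
  let S' := S.filter (· ≠ 0)
  have hS' : AddSubmonoid.closure (S' : Set (σ →₀ ℕ)) = P := by
    refine le_antisymm ?_ ?_
    · rw [← hS]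
      refine AddSubmonoid.closure_mono fun x hx => ?_
      simp only [S', Finset.coe_filter, Set.mem_setOf_eq] at hx
      exact hx.1
    · rw [← hS]
      refine AddSubmonoid.closure_le.2 fun x hx => ?_
      by_cases hx0 : x = 0
      · rw [hx0]; exact AddSubmonoid.zero_mem _
      · refine AddSubmonoid.subset_closure ?_
        simp only [S', Finset.coe_filter, Set.mem_setOf_eq]
        exact ⟨hx, hx0⟩
  refine ⟨S'.card, fun i => (S'.equivFin.symm i : σ →₀ ℕ), fun i => ?_, ?_⟩
  · have h := (S'.equivFin.symm i).2
    simp only [S', Finset.mem_filter] at h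
    exact h.2
  · rw [← hS']
    congr 1
    ext x
    constructor
    · rintro ⟨i, rfl⟩
      exact (S'.equivFin.symm i).2
    · intro hx
      exact ⟨S'.equivFin ⟨x, hx⟩, by simp⟩

/-- **`R⟦P⟧` is Noetherian** for `R` Noetherian and `P ⊆ ℕ^{(σ)}` finitely generated: it is a
quotient of `R⟦X₁, …, X_m⟧`. [cite: Kato1994, §3] -/
theorem isNoetherianRing [IsNoetherianRing R] {P : AddSubmonoid (σ →₀ ℕ)} (hP : P.FG) :
    IsNoetherianRing (monoidPowerSeries R P) := by
  obtain ⟨m, g, hg0, hgP⟩ := exists_generators_ne_zero hP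
  haveI : IsNoetherianRing (MvPowerSeries (Fin m) R) :=
    Literature.AlgebraicGeometry.Resolution.isNoetherianRing_mvPowerSeries R (Fin m)
  exact isNoetherianRing_of_surjective _ _ (substGeneratorsOnto (R := R) g hg0 hgP).toRingHom
    (substGeneratorsOnto_surjective g hg0 hgP)

end monoidPowerSeries

end Literature.RingTheory.MvPowerSeries
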